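import Literature.Barriers.CriticalPhenomena.FKParafermionicHalfCauchyRiemann
import Literature.Probability.LatticeModels.MedialInterfaceProofs
import Literature.Probability.Percolation.Crossings
import HarnessLib

/-!
# Where the boundary flux of the Green identity lives: boundary-adjacent corners only
# (glue for line `iic-trace-flux-pairing`, stub S5 `stub_touchLawOfPairing`, junction of steps (i)–(ii))

Crux `ParafermionToSLESixFamilies` (stmt-CriticalPhenomena-11389), line `iic-trace-flux-pairing`. Step (i)
of S5 sums the vertex relations of the corner observable (support item stmt-11306 `HalfCRVertexRelation`,
Duminil-Copin 2012 Prop. 4) with a weight `ψ` over the set of GUARDED medial vertices — lattice edges of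
`Ω_δ` with both endpoints off the two discrete arcs and both faces inner, verbatim the hypothesis of
stmt-11306 (the "guard", spelled out verbatim below) — and the `ψ`-weighted Green identity
(`Theorems/…IicWeightedGreen.lean`, `sum_weighted_halfCRForm_eq`) leaves a boundary flux over the corners
`(p, k)`, `p` guarded, whose twin medial vertex `HalfCRGreen.twin p k` is NOT guarded. This file locates
those corners on the lattice (`isBoundaryAdjacent_of_isGuarded_of_not_isGuarded`, registered glue): such a
corner `(v, f) = medialCornersAt p k` has an INNER face `f`, its vertex `v` off both arcs, and its other
medial edge (the twin lattice edge, a side of `f` at `v`) ends at a corner `u ≠ v` of `f` lying ON an arc: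
`u ∈ B` — a TOUCH CORNER of `Theorems/…IicTouchPassage.lean` / `touchSites` (the free-arc flux, carrying
`P(v ↔ A)` by DC12 Prop. 5) — or `u ∈ A` (the wired-arc flux). The two other conceivable failures of the
guard at the twin (twin edge not in `Ω_δ`; a non-inner face at the twin edge) are EXCLUDED for admissible
data: the twin edge is a side of the inner face `f`, and a side shared with a non-inner face is a
face-boundary edge, whose endpoints lie on the arcs (`IsZdAdmissible.arcs_cover_faceBoundary`) while `v`
does not. Also: the guarded set is finite (`finite_isGuarded`), so it is a legitimate `S` in the identity.
Pure lattice bookkeeping over the barrier file's certified tables `medialCornersAt`, `HalfCRGreen.twin`.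
-/

noncomputable section

open Literature.Probability.LatticeModels Literature.Probability.Percolation
open Literature.Barriers.CriticalPhenomena
open Literature.Barriers.CriticalPhenomena.HalfCRGreen

namespace Summit.CriticalPhenomena.CardyFormulaZ2.Cruxes.ParafermionToSLESixFamilies.IicTraceFluxPairing

/-! ### Table bookkeeping: the corner `medialCornersAt x i k`, its edge and its twin edge -/

/-- The vertex of the `k`-th corner at the medial vertex `s(x, x + eᵢ)` is an endpoint of that edge. -/
theorem medialCornersAt_fst_eq_or (x : Site 2) (i : Fin 2) (k : Fin 4) :
    (medialCornersAt x i k).1 = x ∨ (medialCornersAt x i k).1 = x + Pi.single i 1 := by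
  fin_cases i <;> fin_cases k <;> simp [medialCornersAt]

/-- The face of the `k`-th corner at `s(x, x + eᵢ)` has both endpoints of that edge as corners. -/
theorem isCorner_edge_medialCornersAt (x : Site 2) (i : Fin 2) (k : Fin 4) :
    IsCorner x (medialCornersAt x i k).2 ∧ IsCorner (x + Pi.single i 1) (medialCornersAt x i k).2 := by
  fin_cases i <;> fin_cases k <;> constructor <;> intro j <;> fin_cases j <;> simp [medialCornersAt]

/-- The face of the `k`-th corner at `s(x, x + eᵢ)` has both endpoints of the TWIN edge as corners, and the
corner's vertex is one of them (the twin edge is the other side of the face at that vertex). -/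
theorem isCorner_twinEdge_medialCornersAt (x : Site 2) (i : Fin 2) (k : Fin 4) :
    IsCorner (twin x i k).1 (medialCornersAt x i k).2 ∧
      IsCorner ((twin x i k).1 + Pi.single (twin x i k).2 1) (medialCornersAt x i k).2 ∧
      ((medialCornersAt x i k).1 = (twin x i k).1 ∨
        (medialCornersAt x i k).1 = (twin x i k).1 + Pi.single (twin x i k).2 1) := by
  fin_cases i <;> fin_cases k <;> refine ⟨?_, ?_, ?_⟩ <;>
    (try (intro j; fin_cases j <;> simp [medialCornersAt, twin])) <;>
    simp [medialCornersAt, twin, funext_iff, Fin.forall_fin_two]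

/-! ### The guard of stmt-11306 and boundary-adjacent corners -/

/-- **Registered glue `isBoundaryAdjacent_of_isGuarded_of_not_isGuarded` — the boundary flux lives on
boundary-adjacent corners.** For admissible data, if the medial vertex `p` is guarded and the twin medial
vertex of its `k`-th corner is not, then the corner `(v, f) = medialCornersAt p k` has an inner face `f`,
`v` lies off both arcs, and the twin edge ends at a corner `u ≠ v` of `f` lying on the arc `A` or on the
arc `B` (in the latter case `(v, f)` is a touch corner). -/
theorem isBoundaryAdjacent_of_isGuarded_of_not_isGuarded : ∀ (E : DiscreteDobrushin), E.IsZdAdmissible → ∀ (p : Site 2 × Fin 2) (k : Fin 4), (s(p.1, p.1 + Pi.single p.2 1) ∈ (discreteDomainGraph E.Ω E.δ).edgeSet ∧ (∀ x ∈ s(p.1, p.1 + Pi.single p.2 1), x ∉ E.zdArcA ∧ x ∉ E.zdArcB) ∧ (∀ f : Site 2, IsCorner p.1 f → IsCorner (p.1 + Pi.single p.2 1) f → E.IsInnerFace f)) → ¬ (s((HalfCRGreen.twin p.1 p.2 k).1, (HalfCRGreen.twin p.1 p.2 k).1 + Pi.single (HalfCRGreen.twin p.1 p.2 k).2 1) ∈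 (discreteDomainGraph E.Ω E.δ).edgeSet ∧ (∀ x ∈ s((HalfCRGreen.twin p.1 p.2 k).1, (HalfCRGreen.twin p.1 p.2 k).1 + Pi.single (HalfCRGreen.twin p.1 p.2 k).2 1), x ∉ E.zdArcA ∧ x ∉ E.zdArcB) ∧ (∀ f : Site 2, IsCorner (HalfCRGreen.twin p.1 p.2 k).1 f → IsCorner ((HalfCRGreen.twin p.1 p.2 k).1 + Pi.single (HalfCRGreen.twin p.1 p.2 k).2 1) f → E.IsInnerFace f)) → E.IsInnerFace (medialCornersAt p.1 p.2 k).2 ∧ (medialCornersAt p.1 p.2 k).1 ∉ E.zdArcA ∧ (medialCornersAt p.1 p.2 k).1 ∉ E.zdArcB ∧ ∃ u : Site 2, IsCorner u (medialCornersAt p.1 p.2 k).2 ∧ u ∈ s((HalfCRGreen.twin p.1 p.2 k).1, (HalfCRGreen.twin p.1 p.2 k).1 + Pi.single (HalfCRGreen.twin p.1 p.2 k).2 1) ∧ u ≠ (medialCornersAt p.1 p.2 k).1 ∧ (u ∈ E.zdArcA ∨ u ∈ E.zdArcB) := by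
  intro E hE p k hp hq
  obtain ⟨x, i⟩ := p
  obtain ⟨-, hoff, hinner⟩ := hp
  set v := (medialCornersAt x i k).1 with hv
  set f := (medialCornersAt x i k).2 with hf
  set y := (twin x i k).1 with hy
  set j := (twin x i k).2 with hj
  -- the face is inner and the vertex is off the arcs (guard at `p`)
  obtain ⟨hxf, hxf'⟩ := isCorner_edge_medialCornersAt x i k
  have hfin : E.IsInnerFace f := hinner f hxf hxf'
  have hvoff : v ∉ E.zdArcA ∧ v ∉ E.zdArcB := by
    rcases medialCornersAt_fst_eq_or x i k with h | h
    · rw [hv, h]; exact hoff x (Sym2.mem_mk_left _ _)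
    · rw [hv, h]; exact hoff _ (Sym2.mem_mk_right _ _)
  obtain ⟨hyf, hy'f, hvy⟩ := isCorner_twinEdge_medialCornersAt x i k
  -- the twin edge is a side of the inner face `f`, hence an edge of `Ω_δ`
  have hadj : (discreteDomainGraph E.Ω E.δ).Adj y (y + Pi.single j 1) :=
    hfin _ _ hyf hy'f ((SimpleGraph.mem_edgeSet _).1 (single_edge_mem y j))
  refine ⟨hfin, hvoff.1, hvoff.2, ?_⟩
  -- the other endpoint of the twin edge
  have hother : ∀ w ∈ s(y, y + Pi.single j 1), w ≠ v → IsCorner w f ∧ w ∈ s(y, y + Pi.single j 1) := by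
    intro w hw _
    rcases Sym2.mem_iff.1 hw with rfl | rfl
    · exact ⟨hyf, hw⟩
    · exact ⟨hy'f, hw⟩
  -- which clause of the guard fails at the twin?
  simp only [not_and_or, not_forall, exists_prop] at hq
  rcases hq with hq | hq | hq
  · exact absurd ((SimpleGraph.mem_edgeSet _).2 hadj) hq
  · -- an endpoint of the twin edge lies on an arc: it is not `v`
    obtain ⟨w, hw, hwarc⟩ := hq
    have hwarc' : w ∈ E.zdArcA ∨ w ∈ E.zdArcB := by tauto
    have hwv : w ≠ v := by
      rintro rfl
      rcases hwarc' with h | h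
      · exact hvoff.1 h
      · exact hvoff.2 h
    exact ⟨w, (hother w hw hwv).1, hw, hwv, hwarc'⟩
  · -- a non-inner face at the twin edge: the twin edge is a face-boundary edge, so `v` is on an arc
    obtain ⟨g, hyg, hy'g, hg⟩ := hq
    have hfb : E.IsFaceBoundaryEdge y (y + Pi.single j 1) := ⟨hadj, ⟨f, hfin, hyf, hy'f⟩, ⟨g, hg, hyg, hy'g⟩⟩
    obtain ⟨h1, h2⟩ := hE.arcs_cover_faceBoundary hfb
    exfalso
    rcases hvy with h | h
    · have hv' : v = y := h
      rw [hv'] at hvoff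
      rcases h1 with h1 | h1
      · exact hvoff.1 h1
      · exact hvoff.2 h1
    · have hv' : v = y + Pi.single j 1 := h
      rw [hv'] at hvoff
      rcases h2 with h2 | h2
      · exact hvoff.1 h2
      · exact hvoff.2 h2

/-- **The guarded medial vertices are finitely many** for admissible data (each is an edge of the finite
graph `Ω_δ`), so their set is a legitimate `S` in the weighted Green identity. -/
theorem finite_isGuarded {E : DiscreteDobrushin} (hE : E.IsZdAdmissible) :
    {p : Site 2 × Fin 2 | s(p.1, p.1 + Pi.single p.2 1) ∈ (discreteDomainGraph E.Ω E.δ).edgeSet ∧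
      (∀ x ∈ s(p.1, p.1 + Pi.single p.2 1), x ∉ E.zdArcA ∧ x ∉ E.zdArcB) ∧
      (∀ f : Site 2, IsCorner p.1 f → IsCorner (p.1 + Pi.single p.2 1) f → E.IsInnerFace f)}.Finite := by
  have hfin := meshDomain_finite hE.isBounded hE.delta_pos (Ω := E.Ω)
  refine (hfin.prod (Set.finite_univ (α := Fin 2))).subset ?_
  rintro ⟨x, i⟩ ⟨he, -, -⟩
  refine ⟨?_, Set.mem_univ _⟩
  exact (discreteDomainGraph_adj_iff.1 ((SimpleGraph.mem_edgeSet _).1 he)).2.1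

/-- **Reading for S5.** Over the finite set `S` of guarded medial vertices, every boundary corner of the
weighted Green identity (`p ∈ S`, twin of its `k`-th corner outside `S`) is boundary-adjacent: a touch corner
(free-arc side) or a wired corner (arc-`A` side). -/
theorem flux_corners_boundaryAdjacent {E : DiscreteDobrushin} (hE : E.IsZdAdmissible)
    {p : Site 2 × Fin 2} (hp : p ∈ (finite_isGuarded hE).toFinset) {k : Fin 4}
    (hk : HalfCRGreen.twin p.1 p.2 k ∉ (finite_isGuarded hE).toFinset) :
    E.IsInnerFace (medialCornersAt p.1 p.2 k).2 ∧ (medialCornersAt p.1 p.2 k).1 ∉ E.zdArcA ∧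
      (medialCornersAt p.1 p.2 k).1 ∉ E.zdArcB ∧
      ∃ u : Site 2, IsCorner u (medialCornersAt p.1 p.2 k).2 ∧
        u ∈ s((HalfCRGreen.twin p.1 p.2 k).1, (HalfCRGreen.twin p.1 p.2 k).1 + Pi.single (HalfCRGreen.twin p.1 p.2 k).2 1) ∧
        u ≠ (medialCornersAt p.1 p.2 k).1 ∧ (u ∈ E.zdArcA ∨ u ∈ E.zdArcB) := by
  rw [Set.Finite.mem_toFinset] at hp hk
  exact isBoundaryAdjacent_of_isGuarded_of_not_isGuarded E hE p k hp hk

end Summit.CriticalPhenomena.CardyFormulaZ2.Cruxes.ParafermionToSLESixFamilies.IicTraceFluxPairing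

end
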